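import Mathlib.Algebra.MvPolynomial.PDeriv
import Mathlib.LinearAlgebra.Matrix.Adjugate
import Mathlib.LinearAlgebra.Matrix.Block
import Mathlib.Tactic.FinCases
import HarnessLib

/-!
# Hu (arXiv:2507.21400, claimed): the Jacobian of the nine chart equations over the Segre stratum of
`Gr(3,5)` — rank `8` in ℘-coordinates, Lemma 8.3's unimodular "pleasant" minor in ℓ-coordinates

`Literature/AlgebraicGeometry/Hu2025/EllChartSegreJacobian.lean`. Referee material for a CLAIMED result
under adjudication (repair cell `pub-hironaka`, unit `b2b-hironaka-cp4` gen 6; files `OBSTRUCTIONS-DIM4.md`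
§16, `HU-CENSUS.md` §R.4, `HU-GAP.md` §3; companions `ThetaDivisorsDependent.lean`,
`GammaSchemeNotIntegral*.lean`). Nothing in this file asserts or denies Hu's theorems: every declaration is
a statement about nine explicit integer polynomials in fifteen variables, their formal partial derivatives
(`MvPolynomial.pderiv`) evaluated at the points of an explicit linear stratum, and two `9 × 9` integer
matrices; the proofs are `simp`/`decide`-level computations valid in every commutative ring.

**Setting.** Yi Hu, *Universal characteristic-free resolution of singularities, I*, arXiv:2507.21400v1
(bib `Hu2025`). For `Gr(3,5)` (`Υ = 3` primary Plücker relations, `|B^gov| = 6`, `dim ℛ = 15`) the cell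
reproduced the universal ϑ- and ℘-blow-up sequence exactly (script `hu35.py`, kit jobs j038826/j039387 of unit
`b2b-hironaka-concerns-g3`; HU-CENSUS.md §R). On the final ℘-chart `8.2143` (Γ-atlas index 0 of j039387),
which passes through the generic point of the transform `Z̃†` of the Segre cone `Z_{x145,x245,x345}`, the
fifteen chart variables are, in this file's numbering,
`0 ε₄` (exceptional parameter that replaced `x124`), `1, 3, 5, 6` (four further transformed Plücker
variables, free along the stratum), `2 ε₁₅` (replaced `x134`), `4 x145`, `7 x245`, `8 x345`,
`9 ζ_ϑ1`, `10 r₁ = x_(134,125)`, `11 ζ_ϑ2`, `12 r₂ = x_(234,125)`, `13 ζ_ϑ3`, `14 r₃ = x_(234,135)`,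
and Hu's nine chart equations `(B^gov_𝔙, L_{𝔉,𝔙})` ([Hu25] Prop. 6.18 / proof of Thm. 8.5) are the
polynomials `eqWP` below (computed, not printed in [Hu25]; HU-CENSUS §R.4, dump j039387):
`B₁₁ = x145 − 1`, `B₁₂ = r₁·x145·ε₄ − 1`, `L₁ = r₁ + ζ_ϑ1 − 1`, `B₂₁ = x245 − ε₄`,
`B₂₂ = r₂·x245·ε₁₅ − 1`, `L₂ = r₂ + ζ_ϑ2 − 1`, `B₃₁ = x345 − ε₁₅`, `B₃₂ = r₃·x345 − 1`,
`L₃ = r₃ + ζ_ϑ3 − 1`. The Segre stratum `S = Z̃† ∩ 𝔙 ≅ 𝔸⁴` is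
`{ε₄ = ε₁₅ = x145 = x245 = x345 = r₁ = r₂ = r₃ = 1, ζ_ϑ1 = ζ_ϑ2 = ζ_ϑ3 = 0}` (coordinates `1,3,5,6` free).

**ℓ-coordinates.** By [Hu25] Prop. 6.11 (9) and its proof (the `ℓ_k`-blow-up ideal on the chart is
`⟨L*_k, δ_(m,u_{F_k})⟩` with `L*_k = L_k − δ`, here `δ = ζ_ϑk`, `L*_k = r_k − 1`; the preferred chart is
`(ξ₀ ≡ 1)`: `ζ_ϑk = L*_k · y_k`, `L_{𝔙,F_k} = 1 + y_k`, `y_k = y_(m,u_{F_k})` a unit along `Ṽ_ℓ`, indeed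
`y_k ≡ −1` there, Cor. 6.13) and because `ζ_ϑk` occurs in none of the six governing binomials (checked on all
16 charts, script `ell_segre_check.py`), the nine equations of `Ṽ_ℓ ∩ 𝔙` on the preferred ℓ-chart are
`eqELL`: the same six binomials and `L_k = 1 + y_k`, with `y_k` stored at the index of `ζ_ϑk` (9, 11, 13).

**What is certified (every commutative ring `R`, every point `v` of `S`).**
* `eqWP_eval_eq_zero`, `eqELL_eval_eq_zero`: the points of `S` (with `ζ = 0`, resp. `y = −1`) satisfy the
  nine equations.
* `wp_alternating_combination`: the alternating combination `c = (−1,1,−1,1,−1,1,−1,1,−1)` of the nine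
  gradient rows of `eqWP` at `v` vanishes on all twelve non-`ζ` columns and equals `(−1, 1, −1)` on the
  columns `(ζ_ϑ1, ζ_ϑ2, ζ_ϑ3)` — the differential shadow of the Plücker syzygy
  `(1 − ζ_ϑ2) = (1 − ζ_ϑ1)(1 − ζ_ϑ3)` along `Ṽ` (`ThetaDivisorsDependent.lean`). Hence
  (`wp_nonzeta_minor_det_eq_zero`, via the adjugate identity `det_eq_zero_of_vecMul_eq_zero`) EVERY `9 × 9`
  minor of the ℘-Jacobian avoiding the three `ζ`-columns is zero at every point of `S`: since the `ζ_ϑk`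
  vanish on `S`, no maximal minor in columns of variables that are units at the point is invertible — the
  computed finding of HU-CENSUS §R.1/§R.4 (j039028: all `C(12,9)` unit-column minors vanish on `S`) with its
  structural reason.
* `ell_pleasant_minor`, `ell_pleasant_minor_det`: in ℓ-coordinates the `9 × 9` minor of the Jacobian of
  `eqELL` on Hu's "pleasant" columns `(x145, r₁, y₁, x245, r₂, y₂, x345, r₃, y₃)` — leading Plücker
  variable, terminating ϱ-variable and `y_(m,u_{F_k})` of each block `k` — is the lower unitriangular matrix
  `pleasantMinor`, of determinant `1`, at every point of `S`: the block-triangular normal form with unit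
  entries asserted by [Hu25] Lemma 8.3 is realised verbatim over the Segre stratum, in every characteristic.
So at `n = 5` the ℓ-blow-ups do exactly what [Hu25] §2.5.4 designs them for, Lemma 8.3 is consistent with
the whole `n = 5` computation (OBSTRUCTIONS-DIM4.md §16 adds: the (REG) test of HU-CENSUS §R.1 has no
violation in ℓ-coordinates), and the located failure of the printed one-sentence general-Γ step at the Segre
cone (HU-GAP §1/§3, G-H1/G-H2) is not a failure of Lemma 8.3: with Hu's own ℓ-transform rule
([Hu25] proof of Lemma 7.5, ℓ-case) `Γ̃⁰_𝔙 = {δ_ℓ1, δ_ℓ2, δ_ℓ3}`, `δ_ℓk = L*_k = r_k − 1`, the restriction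
to `𝔙_Γ = {r₁ = r₂ = r₃ = 1}` deletes exactly the three `r_k`-columns of this minor, after which the six
binomial rows span only the five directions `x145, x245, x345, ε₄, ε₁₅` (`ell_restricted_rank_le`:
an explicit non-trivial combination of the six restricted binomial gradients vanishes), so the rank of the
nine restricted equations is `8 < 9` on every chart, while `Z̃_{ℓ,Γ} = Z̃† ≅ 𝔸⁴` is smooth.
[cite: Hu2025, Prop. 6.11 (9), Cor. 6.13, Lemma 7.5 (ℓ-case), Cor. 7.6, Lemma 8.3, Thm. 8.5 (proof)]
-/

namespace Literature.AlgebraicGeometry.Hu2025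

open MvPolynomial Matrix

noncomputable section

/-- Hu's nine chart equations `(B₁₁, B₁₂, L₁, B₂₁, B₂₂, L₂, B₃₁, B₃₂, L₃)` on the final ℘-chart `8.2143`
of the cell's exact `Gr(3,5)` reproduction (kit job j039387, Γ-atlas index 0), as integer polynomials in the
fifteen chart variables (numbering in the module docstring). Computed by the cell, not printed in [Hu25].
[cite: Hu2025, Prop. 6.18, Thm. 8.5 (proof)] -/
def eqWP : Fin 9 → MvPolynomial (Fin 15) ℤ :=
  ![X 4 - 1, X 10 * X 4 * X 0 - 1, X 10 + X 9 - 1,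
    X 7 - X 0, X 12 * X 7 * X 2 - 1, X 12 + X 11 - 1,
    X 8 - X 2, X 14 * X 8 - 1, X 14 + X 13 - 1]

/-- The same nine equations on the preferred ℓ-chart over it ([Hu25] Prop. 6.11 (9): `ζ_ϑk = L*_k · y_k`,
`L_{𝔙,F_k} = 1 + y_k`; the six binomials are `ζ`-free, hence unchanged), with `y_k` stored at the index of
`ζ_ϑk` (`9, 11, 13`). [cite: Hu2025, Prop. 6.11 (9), Cor. 6.13] -/
def eqELL : Fin 9 → MvPolynomial (Fin 15) ℤ :=
  ![X 4 - 1, X 10 * X 4 * X 0 - 1, 1 + X 9,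
    X 7 - X 0, X 12 * X 7 * X 2 - 1, 1 + X 11,
    X 8 - X 2, X 14 * X 8 - 1, 1 + X 13]

/-- The substitution behind `eqELL`: `L_k = r_k + ζ_k − 1` with `ζ_k = (r_k − 1)·y_k` factors as
`L*_k · (1 + y_k)`, `L*_k = r_k − 1` ([Hu25] proof of Prop. 6.11 (9): `L_{𝔙'} = L* (1 + sgn ξ₁)`).
[cite: Hu2025, Prop. 6.11 (9)] -/
theorem ell_substitution {R : Type*} [CommRing R] (r y : R) :
    r + (r - 1) * y - 1 = (r - 1) * (1 + y) := by ring

variable {R : Type*} [CommRing R]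

/-- The Jacobian entry `∂ e_i / ∂ X_j` of a family of integer polynomials, evaluated at a point `v` of
`R¹⁵` (formal partial derivative `MvPolynomial.pderiv`, then `aeval`). [folklore] -/
def jacAt (e : Fin 9 → MvPolynomial (Fin 15) ℤ) (v : Fin 15 → R) (i : Fin 9) (j : Fin 15) : R :=
  aeval v (pderiv j (e i))

/-- The points of the Segre stratum `S = Z̃† ∩ 𝔙 ≅ 𝔸⁴` on the chart: the eight "unit" coordinates equal `1`
(coordinates `1, 3, 5, 6` are free; the values at `9, 11, 13` — `ζ_ϑk = 0` in ℘-coordinates, `y_k = −1` in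
ℓ-coordinates — are imposed separately where needed). [cite: Hu2025, Thm. 8.5 (proof)] -/
structure OnSegreStratum (v : Fin 15 → R) : Prop where
  h0 : v 0 = 1
  h2 : v 2 = 1
  h4 : v 4 = 1
  h7 : v 7 = 1
  h8 : v 8 = 1
  h10 : v 10 = 1
  h12 : v 12 = 1
  h14 : v 14 = 1

/-- The stratum lies on the ℘-chart model: with `ζ_ϑk = 0` all nine `eqWP` vanish. [folklore] -/
theorem eqWP_eval_eq_zero (v : Fin 15 → R) (hv : OnSegreStratum v)
    (h9 : v 9 = 0) (h11 : v 11 = 0) (h13 : v 13 = 0) (i : Fin 9) : aeval v (eqWP i) = 0 := by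
  obtain ⟨h0, h2, h4, h7, h8, h10, h12, h14⟩ := hv
  fin_cases i <;> simp [eqWP, h0, h2, h4, h7, h8, h10, h12, h14, h9, h11, h13]

/-- The stratum lies on the ℓ-chart model: with `y_k = −1` all nine `eqELL` vanish. [folklore] -/
theorem eqELL_eval_eq_zero (v : Fin 15 → R) (hv : OnSegreStratum v)
    (h9 : v 9 = -1) (h11 : v 11 = -1) (h13 : v 13 = -1) (i : Fin 9) : aeval v (eqELL i) = 0 := by
  obtain ⟨h0, h2, h4, h7, h8, h10, h12, h14⟩ := hv
  fin_cases i <;> simp [eqELL, h0, h2, h4, h7, h8, h10, h12, h14, h9, h11, h13]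

/-- The alternating coefficient vector `c = (−1, 1, −1, 1, −1, 1, −1, 1, −1)` on the rows
`(B₁₁, B₁₂, L₁, B₂₁, B₂₂, L₂, B₃₁, B₃₂, L₃)`. [folklore] -/
def altCoeff : Fin 9 → ℤ := ![-1, 1, -1, 1, -1, 1, -1, 1, -1]

/-- What the alternating combination of the ℘-gradient rows equals, column by column: `0` on the twelve
non-`ζ` columns, `(−1, 1, −1)` on `(ζ_ϑ1, ζ_ϑ2, ζ_ϑ3) = (9, 11, 13)`. [folklore] -/
def zetaGrad : Fin 15 → ℤ := ![0, 0, 0, 0, 0, 0, 0, 0, 0, -1, 0, 1, 0, -1, 0]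

/-- **℘-coordinates: the nine gradient rows are dependent off the `ζ`-columns.** At every point of `S`,
`Σ_i c_i ∂(eqWP_i)/∂X_j = zetaGrad_j`: zero for `j ∉ {9, 11, 13}`, and `−dζ_ϑ1 + dζ_ϑ2 − dζ_ϑ3` on the
`ζ`-columns (the differential of the syzygy `(1 − ζ_ϑ2) − (1 − ζ_ϑ1)(1 − ζ_ϑ3)` at `ζ = 0`, up to sign).
[cite: Hu2025, Thm. 8.5 (proof)] -/
theorem wp_alternating_combination (v : Fin 15 → R) (hv : OnSegreStratum v) (j : Fin 15) :
    ∑ i, (altCoeff i : R) * jacAt eqWP v i j = (zetaGrad j : R) := by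
  obtain ⟨h0, h2, h4, h7, h8, h10, h12, h14⟩ := hv
  fin_cases j <;>
    simp [jacAt, eqWP, altCoeff, zetaGrad, Fin.sum_univ_succ, pderiv_X, h0, h2, h4, h7, h8, h10, h12, h14]

/-- Over any commutative ring: a square matrix with a left-kernel vector having a unit entry has
determinant zero (`c ᵥ* M = 0`, multiply by the adjugate). [folklore] -/
theorem det_eq_zero_of_vecMul_eq_zero {n : Type*} [Fintype n] [DecidableEq n] (M : Matrix n n R)
    (c : n → R) (i₀ : n) (hc : IsUnit (c i₀)) (h : c ᵥ* M = 0) : M.det = 0 := by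
  have h' : c ᵥ* (M * M.adjugate) = 0 := by rw [← vecMul_vecMul, h, zero_vecMul]
  rw [mul_adjugate, vecMul_smul, vecMul_one] at h'
  have h'' := congrFun h' i₀
  simp only [Pi.smul_apply, smul_eq_mul, Pi.zero_apply] at h''
  exact (hc.mul_left_eq_zero).mp h''

/-- **℘-coordinates: every `9 × 9` minor avoiding the `ζ`-columns vanishes on `S`.** For any choice of nine
columns `e` among the twelve non-`ζ` variables, `det (∂ eqWP_i / ∂ X_{e k})(v) = 0` at every point `v` of
the Segre stratum. Since `ζ_ϑ1 = ζ_ϑ2 = ζ_ϑ3 = 0` on `S`, no maximal minor of the ℘-Jacobian in columns of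
variables that are units at the point is invertible there (HU-CENSUS §R.1, j039028).
[cite: Hu2025, Lemma 8.3, Thm. 8.5 (proof)] -/
theorem wp_nonzeta_minor_det_eq_zero (v : Fin 15 → R) (hv : OnSegreStratum v) (e : Fin 9 → Fin 15)
    (he : ∀ k, e k ≠ 9 ∧ e k ≠ 11 ∧ e k ≠ 13) :
    (Matrix.of fun i k => jacAt eqWP v i (e k)).det = 0 := by
  refine det_eq_zero_of_vecMul_eq_zero _ (fun i => (altCoeff i : R)) 0 (by simp [altCoeff]) ?_
  funext k
  have hk := wp_alternating_combination v hv (e k)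
  have hz : (zetaGrad (e k) : R) = 0 := by
    obtain ⟨h9, h11, h13⟩ := he k
    generalize e k = j at h9 h11 h13 ⊢
    fin_cases j <;> simp_all [zetaGrad]
  simpa [vecMul, dotProduct, hz] using hk

/-- Hu's "pleasant" columns for the three blocks: `(x145, r₁, y₁ | x245, r₂, y₂ | x345, r₃, y₃)` =
indices `(4, 10, 9, 7, 12, 11, 8, 14, 13)`. [cite: Hu2025, Lemma 8.3] -/
def pleasantCol : Fin 9 → Fin 15 := ![4, 10, 9, 7, 12, 11, 8, 14, 13]

/-- The value of the pleasant minor at every point of `S`: lower unitriangular, block-diagonal by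
`k = 1, 2, 3` — exactly the shape of [Hu25] Lemma 8.3 (Cases (α)/(β): unit entries, zeros above the
diagonal blocks). [cite: Hu2025, Lemma 8.3] -/
def pleasantMinor : Matrix (Fin 9) (Fin 9) ℤ :=
  !![1, 0, 0, 0, 0, 0, 0, 0, 0;
     1, 1, 0, 0, 0, 0, 0, 0, 0;
     0, 0, 1, 0, 0, 0, 0, 0, 0;
     0, 0, 0, 1, 0, 0, 0, 0, 0;
     0, 0, 0, 1, 1, 0, 0, 0, 0;
     0, 0, 0, 0, 0, 1, 0, 0, 0;
     0, 0, 0, 0, 0, 0, 1, 0, 0;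
     0, 0, 0, 0, 0, 0, 1, 1, 0;
     0, 0, 0, 0, 0, 0, 0, 0, 1]

/-- **ℓ-coordinates: the pleasant minor of the Jacobian of `eqELL` at every point of `S` is `pleasantMinor`.**
[cite: Hu2025, Prop. 6.11 (9), Lemma 8.3] -/
theorem ell_pleasant_minor (v : Fin 15 → R) (hv : OnSegreStratum v) (i k : Fin 9) :
    jacAt eqELL v i (pleasantCol k) = (pleasantMinor i k : R) := by
  obtain ⟨h0, h2, h4, h7, h8, h10, h12, h14⟩ := hv
  fin_cases i <;> fin_cases k <;>
    simp [jacAt, eqELL, pleasantCol, pleasantMinor, pderiv_X, h0, h2, h4, h7, h8, h10, h12, h14]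

/-- `pleasantMinor` is lower triangular. [folklore] -/
theorem pleasantMinor_lowerTriangular : pleasantMinor.BlockTriangular OrderDual.toDual := by
  intro i j hij
  have hij' : i < j := hij
  fin_cases i <;> fin_cases j <;> simp_all [pleasantMinor]

/-- `det pleasantMinor = 1`. [folklore] -/
theorem pleasantMinor_det : pleasantMinor.det = 1 := by
  rw [det_of_lowerTriangular _ pleasantMinor_lowerTriangular]
  simp [pleasantMinor, Fin.prod_univ_succ]

/-- **Lemma 8.3's conclusion over the Segre stratum, in ℓ-coordinates, every characteristic.** At every point
of `S` the `9 × 9` minor of the Jacobian of Hu's nine ℓ-chart equations on the pleasant columns has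
determinant `1`; all nine pleasant variables are units there (`x_k45 = r_k = 1`, `y_k = −1`).
[cite: Hu2025, Lemma 8.3, Thm. 8.5 (proof)] -/
theorem ell_pleasant_minor_det (v : Fin 15 → R) (hv : OnSegreStratum v) :
    (Matrix.of fun i k => jacAt eqELL v i (pleasantCol k)).det = 1 := by
  have hM : (Matrix.of fun i k => jacAt eqELL v i (pleasantCol k))
      = (Int.castRingHom R).mapMatrix pleasantMinor := by
    ext i k; simp [ell_pleasant_minor v hv i k]
  rw [hM, ← RingHom.map_det, pleasantMinor_det, map_one]

/-- **Why the general-Γ sentence still fails there (ℓ-coordinates).** With Hu's ℓ-transform rule the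
restriction to `𝔙_Γ = {δ_ℓ1 = δ_ℓ2 = δ_ℓ3 = 0} = {r₁ = r₂ = r₃ = 1}` deletes the columns `10, 12, 14`;
the six binomial gradient rows of `eqELL` then satisfy the non-trivial relation with coefficients
`(−1, 1, ·, 1, −1, ·, −1, 1, ·)` on EVERY remaining column (they span only `x145, x245, x345, ε₄, ε₁₅`),
so the nine restricted equations have Jacobian rank `≤ 8 < 9` at every point of `Z̃† ≅ 𝔸⁴`.
[cite: Hu2025, Lemma 7.5 (ℓ-case), Cor. 7.6, Thm. 8.5 (proof)] -/
def restrCoeff : Fin 9 → ℤ := ![-1, 1, 0, 1, -1, 0, -1, 1, 0]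

/-- On every column other than the three deleted `r_k`-columns (`10, 12, 14`) the combination
`restrCoeff` of the gradient rows of `eqELL` vanishes at every point of `S`: the six restricted binomial
gradients are linearly dependent, so the nine equations restricted to `𝔙_Γ = {r₁ = r₂ = r₃ = 1}` have
Jacobian rank at most `8`. [cite: Hu2025, Lemma 7.5 (ℓ-case), Cor. 7.6, Thm. 8.5 (proof)] -/
theorem ell_restricted_rank_le (v : Fin 15 → R) (hv : OnSegreStratum v) (j : Fin 15)
    (hj : j ≠ 10 ∧ j ≠ 12 ∧ j ≠ 14) :
    ∑ i, (restrCoeff i : R) * jacAt eqELL v i j = 0 := by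
  obtain ⟨h0, h2, h4, h7, h8, h10, h12, h14⟩ := hv
  obtain ⟨hj10, hj12, hj14⟩ := hj
  fin_cases j <;>
    simp_all [jacAt, eqELL, restrCoeff, Fin.sum_univ_succ, pderiv_X]

end

end Literature.AlgebraicGeometry.Hu2025
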